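import Summits.CriticalPhenomena.PercolationContinuityZ3.Theses.PercLowPointHalfSpace
import Summits.CriticalPhenomena.PercolationContinuityZ3.Theses.PercNonProliferation
import Summits.CriticalPhenomena.PercolationContinuityZ3.Theses.PercDivergentSlabLadder

/-!
# Sketch — crux idea `staircase-bootstrap-floor-decoupling` for `BoundaryTwoArmDecay` (stmt-CriticalPhenomena-0911)

Round 2, ideator 5.  Typed objects of the card; nothing is claimed proved except the exponent
arithmetic `staircase` (kernel-checked) and the transcription `crux_iff`.

Lever: the level census (ideator 3) bounds kisses of ISOLATED pairs by the exact-height density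
`e_n` cleanly (`CensusTruncated`, provable now); every degeneracy of the counting family
(parallel multiplicity, parties = third-party kisses, series necklaces in the bridge picture) is a
COUNT of further kiss edges near the kiss at `f`, and a single RATIO statement
`FloorDecoupling` (quasi-independence of boundary two-arm events at separated floor roots and
separated scales) bounds that count by `S(n) = Σ_{d ≤ 6n} d · P(kiss_{⌊d/3⌋})`, i.e. by
`n^{max(0, 2-a)}` given an a-priori exponent `a`; the census then returns `3 - s - max(0,2-a)`,
a STAIRCASE that climbs from any a-priori `a₀ > 1` (supplied by the GGR/AKN floor count + crux C +
SubpolynomialBlocking) past `5/2` in two rounds (`staircase`).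
-/

noncomputable section

namespace Summit.CriticalPhenomena.PercolationContinuityZ3.Cruxes.BoundaryTwoArmDecay.Staircase

open MeasureTheory Filter Literature.Probability.LatticeModels Literature.Probability.Percolation
open Summit.CriticalPhenomena.PercolationContinuityZ3.Theses

/-- Critical bond percolation on `ℤ³`. -/
abbrev P : Measure (BondConfig (Site 3)) := bondPercolation (zdGraph 3) (criticalProbI 3)

/-- `p_c(ℤ³)` as a real number. -/
abbrev pc : ℝ := ((criticalProbI 3 : unitInterval) : ℝ)

/-- Floor direction `e = (0,1,0)`. -/
abbrev e : Site 3 := Pi.single 1 1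

/-- The half-space above level `l`; `up 0 = ℍ = {x | 0 ≤ x 0}`. -/
def up (l : ℤ) : Set (Site 3) := {x | l ≤ x 0}

/-- Floor sup-distance of a floor site from the origin. -/
def floorSup (x : Site 3) : ℕ := max (x 1).natAbs (x 2).natAbs

/-- The level-`l` component of `x` reaches height `l + n` (vertical reach). -/
def heightGE (l : ℤ) (x : Site 3) (n : ℕ) : Set (BondConfig (Site 3)) :=
  {ω | ∃ y : Site 3, l + (n : ℤ) ≤ y 0 ∧ ω ∈ openConnIn (up l) x y}

/-- Vertical-reach kiss at level `l`, root `x`, direction `e`. -/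
def kissV (l : ℤ) (x : Site 3) (n : ℕ) : Set (BondConfig (Site 3)) :=
  heightGE l x n ∩ heightGE l (x + e) n ∩ (openConnIn (up l) x (x + e))ᶜ

/-- The crux event at a general floor root `x` and floor direction `i` (sup-norm reach `≥ n` from each
endpoint, endpoints in distinct `ℍ`-clusters).  `kissSup n 0 1` is the crux's own set (`crux_iff`). -/
def kissSup (n : ℕ) (x : Site 3) (i : Fin 3) : Set (BondConfig (Site 3)) :=
  {ω | (∃ y : Site 3, (∃ j : Fin 3, (n : ℤ) ≤ |y j - x j|) ∧ ω ∈ openConnIn (up 0) x y) ∧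
       (∃ y : Site 3, (∃ j : Fin 3, (n : ℤ) ≤ |y j - (x + Pi.single i 1 : Site 3) j|) ∧
          ω ∈ openConnIn (up 0) (x + Pi.single i 1 : Site 3) y) ∧
       ω ∉ openConnIn (up 0) x (x + Pi.single i 1 : Site 3)}

/-- Transcription: the crux is the decay of `P(kissSup r 0 1)`. -/
theorem crux_iff :
    PercLowPointHalfSpace.BoundaryTwoArmDecay ↔
      ∃ κ C : ℝ, 0 < κ ∧ ∀ r : ℕ, 1 ≤ r → P.real (kissSup r 0 1) ≤ C * (r : ℝ) ^ (-(5 / 2 + κ)) := by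
  unfold PercLowPointHalfSpace.BoundaryTwoArmDecay kissSup up
  simp only [Pi.zero_apply, sub_zero, zero_add]

/-! ## The new inputs (Q-family) -/

/-- **FloorDecoupling (Q)** — quasi-independence of boundary two-arm events at separated floor roots:
for floor roots `0` and `x` at floor sup-distance `≥ 3m` (the event at `x` has scale `m`, the event at
`0` ANY scale `n`), `P(kiss_n(0,i) ∩ kiss_m(x,j)) ≤ C·P(kiss_n(0,i))·P(kiss_m(x,j))`.  Rate-free,
dimension-free (true in `d = 2` by arm separation, in `d > 6` by asymptotic independence). -/
def FloorDecoupling (C : ℝ) (d₀ : ℕ) : Prop :=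
  ∀ (i j : Fin 3) (n m : ℕ) (x : Site 3), i ≠ 0 → j ≠ 0 → x 0 = 0 → d₀ ≤ m →
    3 * m ≤ floorSup x →
      P.real (kissSup n 0 i ∩ kissSup m x j) ≤ C * P.real (kissSup n 0 i) * P.real (kissSup m x j)

/-- Confinement of the `ℍ`-cluster of `x` to sup-distance `< L`. -/
def confined (L : ℕ) (x : Site 3) : Set (BondConfig (Site 3)) :=
  {ω | ∀ y : Site 3, ω ∈ openConnIn (up 0) x y → ∀ j : Fin 3, |y j - x j| < (L : ℤ)}

/-- **ConfinementLB (Q_conf)** — given the kiss at scale `n`, both clusters stay within `3n` with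
probability at least `n^{-s}` (needed only because `E|U ∩ ∂ℍ| = χ₁₁(p_c) = ∞` makes every EXPECTED
count of far kiss partners infinite; truth: a constant). -/
def ConfinementLB (s : ℝ) : Prop :=
  ∀ᶠ n : ℕ in atTop, (n : ℝ) ^ (-s) * P.real (kissSup n 0 1) ≤
    P.real (kissSup n 0 1 ∩ confined (3 * n) 0 ∩ confined (3 * n) e)

/-! ## The provable parts -/

/-- Kiss edges of `U = C_ℍ(0)` with ANY vertically `n`-tall partner cluster (the pair's own other kiss
edges AND third-party kisses): ordered floor edges `(q₁, q₂)` with `q₁ ∈ U`, `q₂ ∉ U`, `C_ℍ(q₂)` tall. -/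
def partnerKiss (n : ℕ) (ω : BondConfig (Site 3)) : Set (Site 3 × Site 3) :=
  {q | q.1 0 = 0 ∧ q.2 0 = 0 ∧ (zdGraph 3).Adj q.1 q.2 ∧ ω ∈ openConnIn (up 0) 0 q.1 ∧
       ω ∉ openConnIn (up 0) 0 q.2 ∧ ω ∈ heightGE 0 q.2 n}

/-- Their number (`Set.ncard`; `0` on infinite sets — irrelevant on the confined event). -/
def kissCount (n : ℕ) (ω : BondConfig (Site 3)) : ℕ := (partnerKiss n ω).ncard

/-- `e_n := E[ 1{height(U) = n} / |U ∩ ∂ℍ| ]` — exact-height (birth) density (ideator 3). -/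
def eDens (n : ℕ) : ENNReal :=
  ∫⁻ ω, (heightGE 0 0 n \ heightGE 0 0 (n + 1)).indicator
    (fun ω => ((halfSpaceFootprint ω : ℕ∞) : ENNReal)⁻¹) ω ∂P

/-- **CensusTruncated** (FIRST LEMMA, provable now, size M–L): kisses whose root cluster has at most `k`
partner-kiss edges are bounded by `k` times the birth density.  Proof: census identity
`E[mergers] + E[sealed] = E[births] = e_n` (vertical stationarity of the half-space family + BGN), and
`E[mergers] ≥ (p_c³/2)·#{tall footed clusters with ≥ 1 kiss}` (staple the LEX-MIN kiss edge of each
kissing cluster — one fresh 3-edge staple per cluster, no matching, no cycle count), while the kiss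
edges with `kissCount ≤ k` number at most `k` per kissing cluster. -/
def CensusTruncated : Prop :=
  ∃ C : ℝ, ∀ n k : ℕ, 1 ≤ n → 1 ≤ k →
    P.real (kissV 0 0 n ∩ {ω | kissCount n ω ≤ k}) ≤ C * k * (eDens n).toReal

/-- An a-priori two-arm exponent. -/
def Apriori (a : ℝ) : Prop :=
  ∃ C : ℝ, ∀ n : ℕ, 1 ≤ n → P.real (kissSup n 0 1) ≤ C * (n : ℝ) ^ (-a)

/-- **GGR/AKN floor count** (provable now from `BondCentralInequality.lean` on the half-space graph, with
the Cauchy–Schwarz over tall-touched floor edges only): crux C (any `a₁ > 0`) and SubpolynomialBlocking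
(`E N_ℍ(r) ≤ r^s`, every `s`) give `a₂ ≥ 1 + (a₁ - s)/2 - o(1) > 1`. -/
def GGRFloorApriori : Prop :=
  PercLowPointHalfSpace.QuantitativeBGN → PercNonProliferation.SubpolynomialBlocking →
    ∃ a₀ : ℝ, 1 < a₀ ∧ Apriori a₀

/-- The strengthened slab crossover used for the sup-norm ↔ vertical reach reduction (thin slabs of
thickness `n^θ`, `θ > 5/6`, need `A·θ < 1`): `SlabCrossoverPolynomial` of route PercDivergentSlabLadder
(stmt-CriticalPhenomena-6698) with the exponent restricted to `A < A₀`; the line uses `A₀ = 6/5`. -/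
def SlabCrossoverLt (A₀ : ℝ) : Prop :=
  ∃ A C : ℝ, 0 < A ∧ A < A₀ ∧ 0 < C ∧ ∀ k n : ℕ, 1 ≤ k → ∀ x : Site 3,
    P.real {ω | ∃ y : Site 3, (n : ℤ) ≤ max |y 1 - x 1| |y 2 - x 2| ∧
      ω ∈ openConnIn {z : Site 3 | |z 0| ≤ (k : ℤ)} x y} ≤
        C * (k : ℝ) ^ C * Real.exp (-((n : ℝ) / (C * (k : ℝ) ^ A)))

/-- **One round of the staircase** (the analytic heart, to be proved from `FloorDecoupling`,
`ConfinementLB`, `CensusTruncated`, SubpolynomialBlocking (for `ν_n ≤ n^{s-2}` via BK on disjoint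
half-annulus crossings) and `SlabCrossoverLt (6/5)` (reach reduction)): an a-priori exponent `a > 1`
improves to `3 - s - max(0, 2 - a) - δ` for every `s, δ > 0`. -/
def StaircaseStep : Prop :=
  ∀ a : ℝ, 1 < a → Apriori a → ∀ s δ : ℝ, 0 < s → 0 < δ → Apriori (3 - s - δ - max 0 (2 - a))

/-- **The exponent arithmetic** (kernel-checked): from any `a₀ = 1 + η > 1`, two rounds clear `5/2`
as soon as `2(s + δ) < 1/2`. -/
theorem staircase (s δ η : ℝ) (hs : 0 ≤ s) (hδ : 0 ≤ δ) (hη : 0 < η) (h : 2 * (s + δ) < 1 / 2) :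
    (5 : ℝ) / 2 <
      (fun a : ℝ => 3 - s - δ - max 0 (2 - a)) ((fun a : ℝ => 3 - s - δ - max 0 (2 - a)) (1 + η)) := by
  simp only [max_def]
  split_ifs <;> linarith

/-- What the line asserts (composition; the crux BY NAME). -/
def LineCloses : Prop :=
  (∃ C : ℝ, ∃ d₀ : ℕ, FloorDecoupling C d₀) → (∀ s : ℝ, 0 < s → ConfinementLB s) → CensusTruncated →
    GGRFloorApriori → StaircaseStep →
    PercNonProliferation.SubpolynomialBlocking → SlabCrossoverLt (6 / 5) →
    PercLowPointHalfSpace.QuantitativeBGN →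
      PercLowPointHalfSpace.BoundaryTwoArmDecay

/-- The glue from two staircase rounds to the crux is pure arithmetic (`staircase` + `crux_iff`). -/
theorem lineCloses_of_rounds
    (hG : GGRFloorApriori) (hS : StaircaseStep)
    (hB : PercNonProliferation.SubpolynomialBlocking) (hC : PercLowPointHalfSpace.QuantitativeBGN) :
    PercLowPointHalfSpace.BoundaryTwoArmDecay := by
  obtain ⟨a₀, ha₀, hA₀⟩ := hG hC hB
  -- two rounds with s = δ = 1/16 : 2(s+δ) = 1/4 < 1/2
  have h1 := hS a₀ ha₀ hA₀ (1 / 16) (1 / 16) (by norm_num) (by norm_num)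
  have ha₁ : 1 < 3 - 1 / 16 - 1 / 16 - max 0 (2 - a₀) := by
    simp only [max_def]; split_ifs <;> linarith
  have h2 := hS _ ha₁ h1 (1 / 16) (1 / 16) (by norm_num) (by norm_num)
  set a₂ : ℝ := 3 - 1 / 16 - 1 / 16 - max 0 (2 - (3 - 1 / 16 - 1 / 16 - max 0 (2 - a₀))) with ha₂
  have hgt : (5 : ℝ) / 2 < a₂ := by
    have := staircase (1 / 16) (1 / 16) (a₀ - 1) (by norm_num) (by norm_num) (by linarith) (by norm_num)
    simp only at this
    rw [ha₂]
    convert this using 2 <;> ring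
  obtain ⟨C, hCb⟩ := h2
  rw [crux_iff]
  refine ⟨a₂ - 5 / 2, C, by linarith, fun r hr => ?_⟩
  have := hCb r hr
  have hexp : (-(5 / 2 + (a₂ - 5 / 2)) : ℝ) = -a₂ := by ring
  rw [hexp]
  exact this

end Summit.CriticalPhenomena.PercolationContinuityZ3.Cruxes.BoundaryTwoArmDecay.Staircase

end
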